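import Mathlib
import HarnessLib
import Summits.QuantumAdvantage.QuantumAdvantage.Theorems.LocusDialAffinePointerC
import Summits.QuantumAdvantage.QuantumAdvantage.Theorems.StabilizerDialAntipodal
import Summits.QuantumAdvantage.QuantumAdvantage.Theorems.SparsityDialA
import Summits.QuantumAdvantage.QuantumAdvantage.Theorems.SparsityDialRung

/-!
# SparsityDial — part MP1 of 10 of the «MovingPointers» package (decomp-qadv lens 2, g18): §T1–§T2 stretch contraction of the transfer mass; two-phase occupation profile

Parts MP1–MP10 form a LINEAR import chain (MPk imports MPk−1); this docstring carries the overview of the whole package.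

# SparsityDial — part «MovingPointers» = «TwinPointer» (REV 3) + «MultiPointer» (REV 4) + «AffineLookup / AffineTable» (REV 5) + typed residual «PolyTable» (REV 5b) (Theorems-namespace twin of the g18 addendum, LAND-READY; SUPERSEDES the earlier twins `SparsityDialMovingPointers.lean` 67f62741 (REV 4) and `SparsityDialTwinPointer.lean` 175da302, of which it is a superset; decomp-qadv lens 2, generation 18)

THE FIRST LOSS THEOREM FOR **MOVING** MULTI-POINTERS (the critic's «next rung of S = TWO MOVING cheap pointers»,
row 69v33): a strategy whose deviation set at every odd input consists of TWO positions
`π₁(L(x)) < π₂(L(x))` looked up from ANY `𝔽₃`-linear hash `L = linHash M` with `t` forms, the two pointers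
separated (`2j ≤ π₁`, `π₁ + 2j ≤ π₂`), wins at most HALF of the odd class... precisely
`#odd ≤ 2 · #{odd losers}` as soon as `8(t+3) + 20 ≤ j` (`twinPointer_loss`), and the packaged polylog form
`TwinAffinePointerLoss3` (`C = 1`) is PROVED (`twinAffinePointerLoss3`).

METHOD: the g17 transfer operator (`LocusDial.trR/trQ`, parts AffinePointerA–C) extended from ONE kernel phase to
the JOINT distribution of TWO kernel phases `(φ_{k₁}, φ_{k₂})` on a hash fibre.  The twisted sums
`Σ_{x odd} χ(Σ μ_i[x_i] + α(W_{k₁}+W) + β(W_{k₂}+W))` have a THREE-REGION occupation profile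
`c_i = α[i<k₁] + β[i<k₂] + (α+β)[i<N-1]`; for `(α,β) ≠ 0` it is non-zero either on the prefix `[0, k₁)`
(`α+β ≠ 0`) or on the middle stretch `[k₁, k₂)` (`α+β = 0`), so a STRETCH version of the contraction
(`trQ_stretch`, `normSq_trR_le_stretch`: `|R_N|² ≤ 4^{N-2j}·12^j` whenever the occupation phase is non-zero on SOME
window of `2j` steps) bounds all eight twisted fibre sums by `2^N/(432·3^t)`; two-variable orthogonality
(`cell_count`: `9·#cell(a,b) = Σ_{α,β} fibSum2`) puts each of the nine joint cells within `8B` of `#fib/9`, and the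
losing cells (`φ_{k₁} = 2 ⟺ φ_{k₂} = 2`: five of nine) carry `≥ 5/9 − o(1)` of every fibre.

REV 4 «MultiPointer» (§M1–§M6): the same for ANY NUMBER `m` of moving pointers.  A strategy whose deviation set at every
odd input is the image of a SORTED `m`-tuple `π(L(x)) : Fin m → Fin N` of positions (consecutive gaps `≥ 2j`, first
position `≥ 2j`) looked up by ARBITRARY functions from an `𝔽₃`-linear hash with `t` forms satisfies
`#odd ≤ 4 · #{odd losers}` as soon as `8(t+m+3) + 20 ≤ j` (`multiPointer_loss`); packaged with `t, m ≤ (log₂ n)^c` and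
gaps `≥ n / (4 (log₂ n)^c)`: `AffineMultiPointerLoss3` PROVED (`affineMultiPointerLoss3`, `C = 1`), and its S-restricted
form `AffineMultiPointerLossS3` (stated in the `∀ c, ∃ C` order, which makes it LITERALLY a consequence of piece S at
scale `a := c`: `multiS_of_sparse`) PROVED (`affineMultiPointerLossS3`) — piece S is DECIDED on the
whole separated affine-lookup sub-class.  New ingredients: the `m`-region occupation profile
`c_i = Σ_l α_l([i<k_l] + [i<N-1])` is non-zero on the prefix (value `2Σα`) or, when `Σα = 0`, on the stretch just
below the LAST pointer with `α_l ≠ 0` (value `α_l`; `occM_stretch`); `m`-variable orthogonality (`cellM_count`: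
`3^m·#cell(a) = Σ_α fibSumM`); the losing cells are those with an EVEN number of coordinates `≠ 2`
(`lose_iff_of_dev_image`) and they are at least a THIRD of all `3^m` cells (`three_mul_card_evenCells`, a two-to-one
toggling of one coordinate), whence `#fib ≤ 3·#losers(fib) + 3^{m+1}B` per fibre (`fibre_losersM_ge`) and
`#odd ≤ 3·#losers + 2^N/144` globally (`multi_losers_ge`).

REV 5 «AffineLookup» (§C1–§C5, §D1–§D5): ALL POSITION CONSTRAINTS DROPPED — piece S is DECIDED on the WHOLE affine-lookup
class.  `AffineLookupLoss3` (PROVED, `affineLookupLoss3`, `C = 1`): every strategy whose deviation set at each odd input is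
the image of an INJECTIVE tuple of `m ≤ (log₂ n)^c` positions — ANY positions: adjacent, clustered, unsorted, at both ends —
looked up by ARBITRARY functions from an `𝔽₃`-linear hash with `t ≤ (log₂ n)^c` forms wins on at most `(1 − 1/n)·2^{n−1}`
odd inputs (in fact `#odd ≤ 4·#{odd losers}`, `lookup_loss`); its S-restricted form `AffineLookupLossS3` (`∀ c, ∃ C` order;
LITERALLY below piece S by name: `lookupS_of_sparse`) is PROVED (`affineLookupLossS3`); the by-name
ladder `AffineLookupLoss3 → AffinePointersLoss3 → AffineMultiPointerLoss3` (`any_of_lookup`, `multi_of_any`) recovers REV 4.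
New mechanism (replacing separation): (i) a pointer-FREE WINDOW `[w, w+2j)` exists in every fibre by pigeonhole
(`exists_free_window`, `(m+1)·2j + 1 ≤ N`); on it the occupation profile of the twist `α` is the constant `Σ_l s_l α_l` with
the DIRECTION VECTOR `s = dirVec ∈ {1,2}^m` (`1` left of the window, `2` right of it; `occM_window`), so every twist with
`Σ s·α ≠ 0` is small (`fibSumM_bound_window`); (ii) the twists with `Σ s·α = 0` are summed EXACTLY: they count the LINE
`{a − γ s}` through a cell (`line_identity_dir`: `3·Σ_{Σ s·α = 0} fibSumM(α,a) = 3^m·Σ_γ #cell(a − γ s)`), whence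
`Σ_γ #cell(a − γ s) ≤ 3·#cell(a) + 3B` (`line_le_cell_dir`); (iii) the parity lemma `exists_shift_even_dir`: every cell
`b` lies on the line of a LOSING cell (each coordinate is good for exactly two of the three shifts, so the three good-counts
sum to `2m` and are not all odd), and the covering `cover_sum_le_dir` turns (ii) into `#fib ≤ 3·#losers(fib) + 3^{m+1}B`
(`fibre_losers_dir_ge`), `#odd ≤ 3·#losers + 2^N/144` (`dir_losers_ge`).  §C is the prefix special case (`s = 1`, all
pointers `≥ 2j`: `AffinePointersLoss3`, `affinePointersLoss3`).
§E packages the final form, THE AFFINE-TABLE THEOREM `AffineTableLoss3` (PROVED, `affineTableLoss3`): `dev P x = S(L x)` on odd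
inputs for an `𝔽₃`-linear hash `L` with `t ≤ (log₂ n)^c` forms and an ARBITRARY set-valued table `S` with values of size
`≤ (log₂ n)^c` ⇒ at most `(1 − 1/n)·2^{n−1}` odd wins (`table_loss`: `#odd ≤ 4·#{odd losers}`; each table value is enumerated
increasingly by `orderEmbOfFin`, the per-fibre error `3^{m_v+1}·2^N/(432·3^{m_v}·3^t) = 2^N/(144·3^t)` does not depend on the
value's size); S-form `AffineTableLossS3` PROVED (`affineTableLossS3`; below S by name: `tableS_of_sparse`,
via `fewLocus_of_dev_card`); ladder `AffineTableLoss3 → AffineLookupLoss3 → AffinePointersLoss3 → AffineMultiPointerLoss3` by name.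
(The kernel phase `kph x k = k + N + W_k + W_{N−1}`, `W_k = #{i<k : u_i = 1}` with `u` the prefix ZERO-PARITY, is not an
`𝔽₃`-linear function of `x`, so a linear hash cannot read phases: no conflict with pointing at a known-good position.)
§F TYPES THE RESIDUAL OF S: `PolyTableLoss3` / `PolyTableLossS3` = the same tables indexed by `t ≤ (log₂ n)^c` cube
functions of DEGREE `≤ (log₂ n)^c` instead of linear forms (NOT proved; WEAKER than S by name: `polyTableS_of_sparse`; degree
`1` is the proved affine case: `affineTable_of_polyTable`, `affineTableS_of_polyTableS` via the tree's `linPoly_mem`,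
`linPoly_apply`, `lowDeg_mono`); barrier placement: the fibre method would need `3^{-t}`-small correlation of the kernel-automaton
character against `𝔽₃`-polynomial phases of degree `(log₂ n)^c ≫ log n` — inside
`Literature.Barriers.QuantumAdvantage.NonclassicalDegreeLogBarrier` (Bhowmick–Lovett; PROVED in the tree) for derivative /
Gowers-norm arguments; the transfer operator here is the degree-`1` case only.
No `sorry`; standard axioms; no instances / notation.
-/

set_option linter.unusedVariables false
set_option linter.dupNamespace false

noncomputable section
open scoped Classical

namespace Summit.QuantumAdvantage.QuantumAdvantage.Theorems.SparsityDial

open Finset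
open Literature.Computability.QuantumComplexity Literature.Computability.QuantumComplexity.RingHLF
open Literature.Computability.MetaComplexity Literature.Computability.MetaComplexity.Smolensky
open Summit.QuantumAdvantage.AdviceFreeQNC0
open Summit.QuantumAdvantage.QuantumAdvantage.Theorems.HolonomyDial (gCond)
open Summit.QuantumAdvantage.QuantumAdvantage.Theorems.LocusDial
open Summit.QuantumAdvantage.QuantumAdvantage.Theorems.AnchorDial (dev outB win_iff card_odd_ge)
open Summit.QuantumAdvantage.QuantumAdvantage.Theorems.HolonomyDial (card_odd_le)
open Summit.QuantumAdvantage.QuantumAdvantage.Theorems.StabilizerDial (eventually_polylog StabFew stabFew_of_fewLocus)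

/-! ## §T1  The STRETCH contraction of the transfer mass -/

section Stretch

/-- SparsityDial «MovingPointers» helper `trQ_stretch` (decomp-qadv lens-2 g18 land package; see the module docstring). -/
theorem trQ_stretch (μ c : ℕ → ZMod 3) (m : ℕ) : ∀ j : ℕ, (∀ i, m ≤ i → i + 2 ≤ m + 2 * j → c i ≠ 0) →
    trQ μ c (m + 2 * j) ≤ 12 ^ j * trQ μ c m := by
  intro j
  induction j with
  | zero => intro _; simp
  | succ j ih =>
    intro hc
    have ih' := ih (fun i h1 h2 => hc i h1 (by omega))
    have hstep : trQ μ c (m + 2 * j + 2) ≤ 12 * trQ μ c (m + 2 * j) :=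
      trQ_two_step μ c (m + 2 * j) (hc (m + 2 * j) (by omega) (by omega))
    have h12 : (0 : ℝ) ≤ 12 ^ j := by positivity
    calc trQ μ c (m + 2 * (j + 1)) = trQ μ c (m + 2 * j + 2) := by ring_nf
      _ ≤ 12 * trQ μ c (m + 2 * j) := hstep
      _ ≤ 12 * (12 ^ j * trQ μ c m) := by nlinarith [ih', trQ_nonneg μ c (m + 2 * j)]
      _ = 12 ^ (j + 1) * trQ μ c m := by ring

/-- **stretch transfer bound**: if the occupation phases are non-zero on a window of `2j` steps starting at `m`
(`m + 2j ≤ N`), then `|R_N(1)|² ≤ 4^{N-2j}·12^j`. -/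
theorem normSq_trR_le_stretch (μ c : ℕ → ZMod 3) (Nn m j : ℕ) (hmj : m + 2 * j ≤ Nn)
    (hc : ∀ i, m ≤ i → i + 2 ≤ m + 2 * j → c i ≠ 0) :
    Complex.normSq (trR μ c Nn true) ≤ 4 ^ (Nn - 2 * j) * 12 ^ j := by
  have h0 : trQ μ c m ≤ 4 ^ m := by
    have := trQ_add_le μ c 0 m
    rw [Nat.zero_add, trQ_zero, mul_one] at this
    exact this
  have h1 : trQ μ c (m + 2 * j) ≤ 12 ^ j * trQ μ c m := trQ_stretch μ c m j hc
  have h2 : trQ μ c Nn ≤ 4 ^ (Nn - (m + 2 * j)) * trQ μ c (m + 2 * j) := by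
    have := trQ_add_le μ c (m + 2 * j) (Nn - (m + 2 * j))
    rwa [Nat.add_sub_cancel' hmj] at this
  have h3 : Complex.normSq (trR μ c Nn true) ≤ trQ μ c Nn := by
    unfold trQ; nlinarith [Complex.normSq_nonneg (trR μ c Nn false)]
  have e : (4 : ℝ) ^ (Nn - 2 * j) = 4 ^ (Nn - (m + 2 * j)) * 4 ^ m := by
    rw [← pow_add]; congr 1; omega
  have hA : (0 : ℝ) ≤ 4 ^ (Nn - (m + 2 * j)) := by positivity
  have hB : (0 : ℝ) ≤ 12 ^ j := by positivity
  calc Complex.normSq (trR μ c Nn true) ≤ trQ μ c Nn := h3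
    _ ≤ 4 ^ (Nn - (m + 2 * j)) * trQ μ c (m + 2 * j) := h2
    _ ≤ 4 ^ (Nn - (m + 2 * j)) * (12 ^ j * 4 ^ m) := by
        apply mul_le_mul_of_nonneg_left _ hA
        calc trQ μ c (m + 2 * j) ≤ 12 ^ j * trQ μ c m := h1
          _ ≤ 12 ^ j * 4 ^ m := mul_le_mul_of_nonneg_left h0 hB
    _ = 4 ^ (Nn - 2 * j) * 12 ^ j := by rw [e]; ring

variable {N : ℕ}

/-- SparsityDial «MovingPointers» helper `normSq_oddSum_le_stretch` (decomp-qadv lens-2 g18 land package; see the module docstring). -/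
theorem normSq_oddSum_le_stretch (μ c : ℕ → ZMod 3) (m j : ℕ) (hmj : m + 2 * j ≤ N)
    (hc : ∀ i, m ≤ i → i + 2 ≤ m + 2 * j → c i ≠ 0) :
    Complex.normSq (∑ x ∈ (univ : Finset (Fin N → Bool)).filter (fun x => OddZeros x), χ (phaseK μ c N x)) ≤
      4 ^ (N - 2 * j) * 12 ^ j := by
  rw [← trS_top, trS_eq μ c N (le_refl N) true, Nat.sub_self, pow_zero, one_mul]
  exact normSq_trR_le_stretch μ c N m j hmj hc

end Stretch

/-! ## §T2  Two kernel phases: the three-region occupation profile -/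

section TwoPhase
variable {N : ℕ}

/-- occupation phases of `α·(W_{k₁} + W) + β·(W_{k₂} + W)`. -/
def occB (N : ℕ) (α β : ZMod 3) (k₁ k₂ : ℕ) : ℕ → ZMod 3 :=
  fun i => α * ((if i < k₁ then 1 else 0) + (if i < N - 1 then 1 else 0)) +
    β * ((if i < k₂ then 1 else 0) + (if i < N - 1 then 1 else 0))

/-- SparsityDial «MovingPointers» helper `phaseK_app2` (decomp-qadv lens-2 g18 land package; see the module docstring). -/
theorem phaseK_app2 (μ' : Fin N → ZMod 3) (α β : ZMod 3) (k₁ k₂ : ℕ) (x : Fin N → Bool) :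
    phaseK (μA μ') (occB N α β k₁ k₂) N x =
      (∑ i : Fin N, μ' i * (if x i then 1 else 0)) +
        α * (((Wk x k₁ : ℕ) : ZMod 3) + ((Wk x (N - 1) : ℕ) : ZMod 3)) +
        β * (((Wk x k₂ : ℕ) : ZMod 3) + ((Wk x (N - 1) : ℕ) : ZMod 3)) := by
  unfold phaseK
  rw [Wk_cast x k₁, Wk_cast x k₂, Wk_cast x (N - 1)]
  rw [mul_add, mul_add, mul_sum, mul_sum, mul_sum, mul_sum, ← sum_add_distrib, ← sum_add_distrib,
    ← sum_add_distrib, ← sum_add_distrib]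
  apply sum_congr rfl
  intro i _
  rw [if_pos i.isLt]
  have hμ : μA μ' i.val = μ' i := by
    unfold μA; rw [dif_pos i.isLt]
  rw [hμ]
  unfold occB
  by_cases hu : uCoord x i = true
  · simp only [hu, and_true]
    split_ifs <;> ring
  · simp [hu]

/-- **two-phase odd-class character sum bound** (stretch form): for `(α, β) ≠ (0,0)`, `2j ≤ k₁`, `k₁ + 2j ≤ k₂ < N`. -/
theorem normSq_appSum2_le (μ' : Fin N → ZMod 3) (α β : ZMod 3) (hαβ : ¬ (α = 0 ∧ β = 0)) (k₁ k₂ j : ℕ)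
    (h1 : 2 * j ≤ k₁) (h2 : k₁ + 2 * j ≤ k₂) (h3 : k₂ + 1 ≤ N) :
    Complex.normSq (∑ x ∈ (univ : Finset (Fin N → Bool)).filter (fun x => OddZeros x),
      χ ((∑ i : Fin N, μ' i * (if x i then 1 else 0)) +
        α * (((Wk x k₁ : ℕ) : ZMod 3) + ((Wk x (N - 1) : ℕ) : ZMod 3)) +
        β * (((Wk x k₂ : ℕ) : ZMod 3) + ((Wk x (N - 1) : ℕ) : ZMod 3)))) ≤
      4 ^ (N - 2 * j) * 12 ^ j := by
  by_cases hs : α + β = 0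
  · have h := normSq_oddSum_le_stretch (N := N) (μA μ') (occB N α β k₁ k₂) k₁ j (by omega) (by
      intro i hi1 hi2
      unfold occB
      rw [if_neg (show ¬ i < k₁ by omega), if_pos (show i < N - 1 by omega), if_pos (show i < k₂ by omega)]
      revert hs hαβ
      revert α β
      decide)
    simp_rw [phaseK_app2] at h
    exact h
  · have h := normSq_oddSum_le_stretch (N := N) (μA μ') (occB N α β k₁ k₂) 0 j (by omega) (by
      intro i _ hi2
      unfold occB
      rw [if_pos (show i < k₁ by omega), if_pos (show i < N - 1 by omega), if_pos (show i < k₂ by omega)]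
      revert hs hαβ
      revert α β
      decide)
    simp_rw [phaseK_app2] at h
    exact h

/-- exponent budget (stretch form of the tree's `pow_budget'`). -/
theorem pow_budget2 (t N j : ℕ) (h2j : 2 * j ≤ N) (hjt : 8 * t + 20 ≤ j) :
    (256 : ℝ) * 9 ^ t * (4 ^ (N - 2 * j) * 12 ^ j) ≤ 4 ^ N := by
  have hb := pow_budget t j hjt
  have e12 : (12 : ℝ) ^ j = 3 ^ j * 4 ^ j := by rw [← mul_pow]; norm_num
  have e4 : (4 : ℝ) ^ N = 4 ^ (N - 2 * j) * 4 ^ j * 4 ^ j := by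
    rw [← pow_add, ← pow_add]; congr 1; omega
  rw [e12, e4]
  have hbR : (256 : ℝ) * 9 ^ t * 3 ^ j ≤ 4 ^ j := by exact_mod_cast hb
  have hp : (0 : ℝ) ≤ 4 ^ (N - 2 * j) * 4 ^ j := by positivity
  calc (256 : ℝ) * 9 ^ t * (4 ^ (N - 2 * j) * (3 ^ j * 4 ^ j))
      = (4 ^ (N - 2 * j) * 4 ^ j) * (256 * 9 ^ t * 3 ^ j) := by ring
    _ ≤ (4 ^ (N - 2 * j) * 4 ^ j) * 4 ^ j := mul_le_mul_of_nonneg_left hbR hp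
    _ = 4 ^ (N - 2 * j) * 4 ^ j * 4 ^ j := by ring

/-- the two-phase bound in the usable form `16·3^t·‖Σ‖ ≤ 2^N` (`8t + 20 ≤ j`). -/
theorem norm_appSum2_le (μ' : Fin N → ZMod 3) (α β : ZMod 3) (hαβ : ¬ (α = 0 ∧ β = 0)) (k₁ k₂ j t : ℕ)
    (h1 : 2 * j ≤ k₁) (h2 : k₁ + 2 * j ≤ k₂) (h3 : k₂ + 1 ≤ N) (hjt : 8 * t + 20 ≤ j) :
    (16 : ℝ) * 3 ^ t * ‖∑ x ∈ (univ : Finset (Fin N → Bool)).filter (fun x => OddZeros x),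
      χ ((∑ i : Fin N, μ' i * (if x i then 1 else 0)) +
        α * (((Wk x k₁ : ℕ) : ZMod 3) + ((Wk x (N - 1) : ℕ) : ZMod 3)) +
        β * (((Wk x k₂ : ℕ) : ZMod 3) + ((Wk x (N - 1) : ℕ) : ZMod 3)))‖ ≤ 2 ^ N := by
  set Z := ∑ x ∈ (univ : Finset (Fin N → Bool)).filter (fun x => OddZeros x),
      χ ((∑ i : Fin N, μ' i * (if x i then 1 else 0)) +
        α * (((Wk x k₁ : ℕ) : ZMod 3) + ((Wk x (N - 1) : ℕ) : ZMod 3)) +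
        β * (((Wk x k₂ : ℕ) : ZMod 3) + ((Wk x (N - 1) : ℕ) : ZMod 3))) with hZ
  have hn1 : Complex.normSq Z ≤ 4 ^ (N - 2 * j) * 12 ^ j := normSq_appSum2_le μ' α β hαβ k₁ k₂ j h1 h2 h3
  have hn2 := pow_budget2 t N j (by omega) hjt
  rw [Complex.normSq_eq_norm_sq] at hn1
  have hsq : ((16 : ℝ) * 3 ^ t * ‖Z‖) ^ 2 ≤ ((2 : ℝ) ^ N) ^ 2 := by
    have e : ((2 : ℝ) ^ N) ^ 2 = 4 ^ N := by rw [← pow_mul, mul_comm, pow_mul]; norm_num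
    rw [e]
    have : (0 : ℝ) ≤ 256 * 9 ^ t := by positivity
    calc ((16 : ℝ) * 3 ^ t * ‖Z‖) ^ 2 = 256 * 9 ^ t * ‖Z‖ ^ 2 := by
          rw [mul_pow, mul_pow, ← pow_mul, show (16 : ℝ) ^ 2 = 256 by norm_num]
          congr 2
          rw [mul_comm, pow_mul]; norm_num
      _ ≤ 256 * 9 ^ t * (4 ^ (N - 2 * j) * 12 ^ j) := mul_le_mul_of_nonneg_left hn1 this
      _ ≤ 4 ^ N := hn2
  have ha0 : (0 : ℝ) ≤ 16 * 3 ^ t * ‖Z‖ := by positivity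
  have hb0 : (0 : ℝ) ≤ 2 ^ N := by positivity
  calc (16 : ℝ) * 3 ^ t * ‖Z‖ = Real.sqrt (((16 : ℝ) * 3 ^ t * ‖Z‖) ^ 2) := (Real.sqrt_sq ha0).symm
    _ ≤ Real.sqrt (((2 : ℝ) ^ N) ^ 2) := Real.sqrt_le_sqrt hsq
    _ = 2 ^ N := Real.sqrt_sq hb0

end TwoPhase


end Summit.QuantumAdvantage.QuantumAdvantage.Theorems.SparsityDial
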